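import Mathlib
import HarnessLib

/-!
# Contraction trees: cost, width, and the slicing trade-off (Gray–Kourtis 2021 §2, §4.7.1)

Topic `Literature/Computability/QuantumComplexity` (pub-qadeq lane; the COST-BASIS vocabulary of the
random-circuit-sampling rows E-01…E-10 and E-22, whose "classical cost" cells are tensor-network
contraction estimates: CLAIMS E-04 "67×32 = 1×10¹³ yr GPU-sliced TN / all-RAM 6×10⁴ yr", E-08
"cotengra hyper-optimized exact contraction of one amplitude … unconstrained FLOPs ‘∼10²⁰’ at
`d = 12` …, width-2³⁰-sliced (40–80 GB GPUs) median cost ‘continues to exponentially grow to ∼10³⁰’",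
E-09 "widths `W = ∞ / 54 / 49 / 30`", and spoof-1's reachability estimates "largest intermediate tensor
≤ 2³¹ complex64 entries per job").  What those sentences quantify — the contraction COST `C` of a
contraction tree, its WIDTH `W` (largest intermediate tensor), and what SLICING does to both — is
fixed here as printed, with the elementary inequalities behind "slicing reduces memory at the price
of redundantly repeated operations" PROVED.

HONEST FRAMING: instance-level adjudication of specific advantage claims; no claim about BQP vs BPP
or the summit.  Finite combinatorial identities about ONE given contraction tree; nothing here finds
good trees (the NP-hard optimisation the cited tools attack heuristically), nothing bounds the cost of
any particular circuit, and "FLOPs per second" of any machine is not modelled.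

## Sources (verbatim)

[GrayKourtis2021] J. Gray, S. Kourtis, *Hyper-optimized tensor network contraction*, Quantum 5, 410
(2021) = arXiv:2002.01935, §2 "Problem statement" (tex chunk p0005 of `lit read arxiv:2002.01935`):
"To represent the sequence of vertex contractions, we define a rooted binary tree `B = (V_B, E_B)`,
with the first `|V|` vertex indices denoting leaves … we assign an incidence set `s_v` to each
`v ∈ V_B`, starting with leaves, according to `s_v = {e : e ∈ E and v ∈ e}` if `v` is a leaf index,
`s_{l(v)} ⊕ s_{r(v)}` otherwise, with `s_i ⊕ s_j = (s_i ∪ s_j) \ (s_i ∩ s_j)`. The composite of `(B,S)`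
… defines a contraction tree of `G`. … the total space required for the contraction of a network is
given, up to an `O(|V|)` prefactor, by `2^W`, for contraction width `W = ec_max(B,S)` …
`ec_max(B,S) = max_{v∈V_B} Σ_{e∈s_v} log₂ w(e)`. … For systems of boolean variables or qubits,
`w = 2` and `ec_max(B,S) = max_{v∈V_B} |s_v|`. … the time complexity of the contraction is captured
by the contraction cost `C(B,S) = Σ_{v∈V_B} 2^{vc(B,S,v)}`, where
`vc(B,S,v) = Σ_{e ∈ s_{l(v)} ∪ s_{r(v)}} log₂ w(e)`. … the number of operations required to obtain
the tensor corresponding to a non-leaf vertex `v` by contracting its children is proportional to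
`2^{|s_{l(v)} ∪ s_{r(v)}|}`. More precisely, assuming every contraction is an inner product, for real
(complex) tensors, the associated FLOP count will be a factor of two (eight) times more than `C`".
§4.7.1 "Slicing" (chunk p0014): "we can also choose to perform any subset of the summations last …
We'll call the corresponding set of indices `s_sliced`. For each fixed value of this exterior sum,
the remaining expression corresponds to a tensor network of `|V|` nodes, but with all the edges in
`s_sliced` removed. … The total number of such sliced tensor networks is then
`d_sliced = ∏_{e ∈ s_sliced} w(e)`, each of which can be contracted independently, optionally using
the same tree as the original network. The advantage of doing this is twofold: (i) the contraction
width and thus required memory of each sliced tensor network, `W_s`, is generally reduced; and (ii)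
the sum over independent contractions is ‘embarrassingly parallel’ … The disadvantage is that the
contraction cost of each sliced tensor network generally increases beyond `C / d_sliced` (due to
redundantly repeated contractions) meaning the total sliced cost, `C_s`, rises."

[DeCrossEtAl2025] M. DeCross et al., Phys. Rev. X 15, 021052 (2025) = arXiv:2406.02501 (row E-08),
§III A (arXiv p. 5, L38–48): "The contraction costs reported in this manuscript are obtained using
cotengra [20] … contraction order is optimized by targeting the minimization of floating-point
operations (FLOPs) assuming no memory constraints. Since we have not performed exhaustive searches
… all reported costs are, strictly speaking, only upper bounds on the true contraction cost"; §III B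
(p. 7 L86–p. 8 L12): "TN simulations of random quantum circuits [22–24] have favored a technique
called slicing [25, 26] that instead breaks the computation into many independent tasks, each able
to fit onto a single GPU. … The potentially enormous reduction in memory footprint is not always
free however, and at some point redundantly repeated operations introduce significant overhead. …
in the sliced case enforce a maximum tensor size, or ‘width’ `W = 2³⁰` … even though the slicing
reduces `W` by a factor of up to `2²⁶ ∼ 64` million, it introduces no significant overhead."

[MorvanEtAl2024] A. Morvan et al., Nature 634, 328 (2024) (row E-04), Appendix G (publisher SI p. 26,
L53–67): "The time and memory complexities of the contraction of such a tensor network depend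
strongly on the order in which tensors are contracted. … Ref. [24] introduced a method to alleviate
the memory requirements for the contraction of a tensor network at the expense of a larger time
complexity. This method involves slicing (projecting) certain carefully chosen indices in the
network to the different values in their support. Each slice yields a tensor network that requires
less memory to be contracted, although one has to contract a number of tensor networks that scales
exponentially in the number of indices sliced."

## Contents (all proved, 0 named facts)

Model: indices (edges) `E` with bond dimensions `w : E → ℕ` (GK's `w(e)`); a contraction tree is
the inductive `CTree E` — a leaf carries the incidence set `s_v ⊆ E` of one input tensor, a node is
one pairwise contraction; products replace GK's `2^{Σ log₂ w}` (equal for integer dimensions).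

* `CTree.openIdx` — `s_v`, GK eq. (`s_v = s_l ⊕ s_r`); `CTree.cost w` — `C(B,S) = Σ_{v internal}
  ∏_{e ∈ s_l ∪ s_r} w(e)` (`= Σ 2^{vc}`); `CTree.maxSize w` — `2^W = max_v ∏_{e∈s_v} w(e)`;
  `CTree.width` — the qubit case `max_v |s_v|` (`maxSize_two : maxSize 2 = 2^width`);
  `complexFlops = 8·C` (GK's "factor of … eight").
* `CTree.slice Z` — the sliced network "with all the edges in `s_sliced` removed", "using the same
  tree"; `openIdx_slice : s_v ↦ s_v \ Z`; `numSlices w Z = d_sliced = ∏_{e∈Z} w(e)`;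
  `slicedCost w Z t = C_s = d_sliced · C(sliced tree)`, `slicedCost_eq_sum` (`C_s` is the sum over the
  `d_sliced` independent slice assignments — "each of which can be contracted independently").
* **`cost_le_slicedCost`** (`C ≤ C_s`: "the contraction cost of each sliced tensor network generally
  increases beyond `C / d_sliced` … meaning the total sliced cost `C_s` rises"; Morvan "at the
  expense of a larger time complexity"); **`slicedCost_eq_cost`** (no overhead exactly when every
  contraction involves all sliced indices — DeCross's "introduces no significant overhead" regime,
  `EveryContractionContains`); `cost_slice_le` (each slice alone is no dearer: `C(slice) ≤ C`).
* **`maxSize_slice_le`**, `width_slice_le`, `prod_openIdx_slice_mul` (memory: every tensor of a slice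
  is the original divided by `∏_{e ∈ s_v ∩ Z} w(e)` — "reduces `W` by a factor of up to `2²⁶`",
  "requires less memory").
* `mem_openIdx_iff_odd` (the `⊕`-recursion makes `s_v` = the indices carried by an odd number of the
  leaves below `v`), `openIdx_eq_empty_of_leafCount_two` (a closed network — every index on exactly
  two tensors, e.g. one amplitude — contracts to a scalar), `mem_openIdx_of_leafCount_one` (output
  indices stay open), `prod_openIdx_le_cost` (the cost dominates every intermediate tensor's size).

## Not here

Finding good trees / orderings (treewidth, hypergraph partitioning, the optimisers of GK §3–4 and
cotengra), lower bounds on `C` over all trees, caching across slices, approximate (compressed)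
contraction, and any number attached to a specific circuit or supercomputer.  Mathlib has no tensor
networks; searched `lean search 'contractionCost|contractionTree|TensorNetwork|einsum|slicing|treewidth'`
— nothing relevant in the tree (the MPS files `MatrixProductState*.lean` and
`Probability/GraphicalModels/TreeBeliefPropagation.lean` are different objects).
-/

namespace Literature.Computability.QuantumComplexity.TensorContraction

/-- A **contraction tree** (Gray–Kourtis's rooted binary tree `B` with incidence sets): a leaf is an
input tensor, recorded by its incidence set `s_v ⊆ E` of indices; a node is the pairwise contraction
of its two subtrees. [cite: GrayKourtis2021, §2 (definition of the contraction tree (B,S))] -/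
inductive CTree (E : Type*) : Type _
  | leaf : Finset E → CTree E
  | node : CTree E → CTree E → CTree E

namespace CTree

variable {E : Type*}

section NoDec

/-- The number of sliced networks `d_sliced = ∏_{e ∈ s_sliced} w(e)` ("The total number of such
sliced tensor networks"). [cite: GrayKourtis2021, §4.7.1] -/
def numSlices (w : E → ℕ) (Z : Finset E) : ℕ := ∏ e ∈ Z, w e

/-- Unfolding of `numSlices`. [cite: GrayKourtis2021, §4.7.1 (d_sliced)] -/
theorem numSlices_eq (w : E → ℕ) (Z : Finset E) : numSlices w Z = ∏ e ∈ Z, w e := rfl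

/-- `d_sliced ≥ 1` for positive bond dimensions. [cite: GrayKourtis2021, §4.7.1 (d_sliced)] -/
theorem one_le_numSlices {w : E → ℕ} (hw : ∀ e, 1 ≤ w e) (Z : Finset E) : 1 ≤ numSlices w Z := by
  show 0 < ∏ e ∈ Z, w e
  exact Finset.prod_pos fun e _ => hw e

end NoDec

variable [DecidableEq E]

/-- `d_sliced` is the number of assignments of values to the sliced indices ("scales exponentially in
the number of indices sliced"). [cite: GrayKourtis2021, §4.7.1] [cite: MorvanEtAl2024, Appendix G (SI p. 26)] -/
theorem card_sliceAssignments (w : E → ℕ) (Z : Finset E) :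
    Fintype.card ((e : Z) → Fin (w e)) = numSlices w Z := by
  rw [Fintype.card_pi, numSlices_eq, ← Finset.prod_coe_sort Z]
  simp only [Fintype.card_fin]

/-! ### Incidence sets, cost, width -/

/-- The **incidence set** `s_v` of the root vertex: the leaf's own index set, and
`s_v = s_{l(v)} ⊕ s_{r(v)}` (symmetric difference: shared indices are summed, the rest stay open) at
a contraction. [cite: GrayKourtis2021, §2 (display defining s_v)] -/
def openIdx : CTree E → Finset E
  | leaf s => s
  | node l r => symmDiff (openIdx l) (openIdx r)

/-- The **contraction cost** `C(B,S) = Σ_{v} 2^{vc(B,S,v)}`, `vc(v) = Σ_{e ∈ s_{l(v)} ∪ s_{r(v)}}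
log₂ w(e)`: each pairwise contraction costs the product of the dimensions of ALL indices of its two
operands ("the number of operations required to obtain the tensor corresponding to a non-leaf vertex
`v` by contracting its children is proportional to `2^{|s_{l(v)} ∪ s_{r(v)}|}`"); leaves cost nothing.
[cite: GrayKourtis2021, §2 (displays defining C(B,S) and vc)] -/
def cost (w : E → ℕ) : CTree E → ℕ
  | leaf _ => 0
  | node l r => cost w l + cost w r + ∏ e ∈ openIdx l ∪ openIdx r, w e

/-- The **largest tensor** over all vertices of the tree, `2^W = max_{v ∈ V_B} ∏_{e ∈ s_v} w(e)`
(`W = ec_max(B,S)` the contraction width; "the total space required … is given, up to an `O(|V|)`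
prefactor, by `2^W`"). [cite: GrayKourtis2021, §2 (displays defining W and ec_max)] [cite: DeCrossEtAl2025, §III B ("Size of the largest intermediate tensor, or ‘contraction width’, W")] -/
def maxSize (w : E → ℕ) : CTree E → ℕ
  | leaf s => ∏ e ∈ s, w e
  | node l r => max (max (maxSize w l) (maxSize w r)) (∏ e ∈ symmDiff (openIdx l) (openIdx r), w e)

/-- The **contraction width for qubit networks**: `W = max_{v ∈ V_B} |s_v|` ("For systems of boolean
variables or qubits, `w = 2` and `ec_max(B,S) = max_{v∈V_B} |s_v|`"). [cite: GrayKourtis2021, §2] -/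
def width : CTree E → ℕ
  | leaf s => s.card
  | node l r => max (max (width l) (width r)) (symmDiff (openIdx l) (openIdx r)).card

/-- FLOP count of a complex contraction: "for real (complex) tensors, the associated FLOP count will be
a factor of two (eight) times more than `C`" (the unit of the RCS rows' cost cells).
[cite: GrayKourtis2021, §2 (sentence after the definition of vc)] [cite: DeCrossEtAl2025, §III B ("contraction cost in FLOPs (assuming complex tensors)")] -/
def complexFlops (w : E → ℕ) (t : CTree E) : ℕ := 8 * cost w t

/-- Unfolding of `complexFlops`. [cite: GrayKourtis2021, §2] -/
theorem complexFlops_eq (w : E → ℕ) (t : CTree E) : complexFlops w t = 8 * cost w t := rfl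

/-- The cost of one contraction step on top of its subtrees (qubit case: `+ 2^{|s_l ∪ s_r|}`).
[cite: GrayKourtis2021, §2 ("proportional to 2^{|s_{l(v)} ∪ s_{r(v)}|}")] -/
theorem cost_node_two (l r : CTree E) :
    cost (fun _ => 2) (node l r) =
      cost (fun _ => 2) l + cost (fun _ => 2) r + 2 ^ (openIdx l ∪ openIdx r).card := by
  simp [cost, Finset.prod_const]

/-- Qubit networks: the largest tensor is `2^W` with `W = max_v |s_v|`.
[cite: GrayKourtis2021, §2 ("w = 2 and ec_max(B,S) = max_{v∈V_B} |s_v|")] -/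
theorem maxSize_two (t : CTree E) : maxSize (fun _ => 2) t = 2 ^ width t := by
  have hmono : Monotone (fun n : ℕ => 2 ^ n) := fun a b h => Nat.pow_le_pow_right (by norm_num) h
  induction t with
  | leaf s => simp [maxSize, width, Finset.prod_const]
  | node l r ihl ihr =>
    simp only [maxSize, width, ihl, ihr, Finset.prod_const]
    rw [← hmono.map_max, ← hmono.map_max]

/-! ### Which indices stay open -/

/-- The number of leaves (input tensors) below the root that carry the index `e`. [cite: GrayKourtis2021, §2 (s_v = {e : v ∈ e} at leaves)] -/
def leafCount (e : E) : CTree E → ℕ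
  | leaf s => if e ∈ s then 1 else 0
  | node l r => leafCount e l + leafCount e r

/-- The `⊕`-recursion unrolled: an index is open at the root iff an ODD number of the input tensors
carry it ("Each vertex contraction removes common edges between pairs of tensors").
[cite: GrayKourtis2021, §2 (s_v = s_l ⊕ s_r)] -/
theorem mem_openIdx_iff_odd (e : E) (t : CTree E) : e ∈ t.openIdx ↔ Odd (leafCount e t) := by
  induction t with
  | leaf s => by_cases h : e ∈ s <;> simp [openIdx, leafCount, h]
  | node l r ihl ihr =>
    simp only [openIdx, leafCount, Finset.mem_symmDiff, ihl, ihr, Nat.odd_add]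
    constructor
    · rintro (⟨h1, h2⟩ | ⟨h1, h2⟩)
      · exact ⟨fun _ => (Nat.not_odd_iff_even).1 h2, fun _ => h1⟩
      · exact ⟨fun h => absurd h h2, fun h => absurd ((Nat.not_even_iff_odd).2 h1) (not_not.2 h)⟩
    · intro h
      by_cases hl : Odd (leafCount e l)
      · exact Or.inl ⟨hl, (Nat.not_odd_iff_even).2 (h.1 hl)⟩
      · exact Or.inr ⟨by
          by_contra hr
          exact hl (h.2 ((Nat.not_odd_iff_even).1 hr)), hl⟩

/-- A **closed** network (every index on exactly two tensors — e.g. the network of one output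
amplitude, "all vertices in `V` are contracted into a single vertex") contracts to a scalar: no open
index at the root. [cite: GrayKourtis2021, §2 ("We assume that G initially has no loops … multiple edges are always contracted simultaneously")] -/
theorem openIdx_eq_empty_of_leafCount_two {t : CTree E} (h : ∀ e, leafCount e t = 2) :
    t.openIdx = ∅ := by
  ext e
  simp only [Finset.notMem_empty, iff_false, mem_openIdx_iff_odd, h]
  decide

/-- An index carried by exactly one input tensor (an output / hyper-index stub) stays open.
[cite: GrayKourtis2021, §2 ("For some applications, only a subset of V must be contracted")] -/
theorem mem_openIdx_of_leafCount_one {t : CTree E} {e : E} (h : leafCount e t = 1) :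
    e ∈ t.openIdx := by
  rw [mem_openIdx_iff_odd, h]; exact odd_one

/-! ### Elementary product inequalities (bond dimensions `≥ 1`) -/

omit [DecidableEq E] in
/-- `(A \ Z) ⊕ (B \ Z) = (A ⊕ B) \ Z`. [folklore] -/
private theorem symmDiff_sdiff_sdiff (A B Z : Finset E) [DecidableEq E] :
    symmDiff (A \ Z) (B \ Z) = symmDiff A B \ Z := by
  ext e
  simp only [Finset.mem_symmDiff, Finset.mem_sdiff]
  tauto

/-- `(A \ Z) ∪ (B \ Z) = (A ∪ B) \ Z`. [folklore] -/
private theorem union_sdiff_eq (A B Z : Finset E) : A \ Z ∪ B \ Z = (A ∪ B) \ Z := by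
  ext e; simp only [Finset.mem_union, Finset.mem_sdiff]; tauto

/-- A product of dimensions `≥ 1` over a subset is no larger. [folklore] -/
private theorem prod_le_prod_of_subset {w : E → ℕ} (hw : ∀ e, 1 ≤ w e) {s t : Finset E}
    (h : s ⊆ t) : ∏ e ∈ s, w e ≤ ∏ e ∈ t, w e := by
  rw [← Finset.prod_sdiff h]
  exact Nat.le_mul_of_pos_left _ (Finset.prod_pos fun e _ => hw e)

/-- `∏_{U \ Z} · ∏_{U ∩ Z} = ∏_U`. [folklore] -/
private theorem prod_sdiff_mul_prod_inter (w : E → ℕ) (U Z : Finset E) :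
    (∏ e ∈ U \ Z, w e) * ∏ e ∈ U ∩ Z, w e = ∏ e ∈ U, w e := by
  rw [← Finset.sdiff_inter_self_left U Z]
  exact Finset.prod_sdiff Finset.inter_subset_left

/-- The cost dominates the size of every intermediate tensor: `∏_{e ∈ s_v} w(e) ≤ C` at any internal
vertex (`s_v = s_l ⊕ s_r ⊆ s_l ∪ s_r`). [cite: GrayKourtis2021, §2 (s_v ⊆ s_{l(v)} ∪ s_{r(v)})] -/
theorem prod_openIdx_le_cost {w : E → ℕ} (hw : ∀ e, 1 ≤ w e) (l r : CTree E) :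
    ∏ e ∈ (node l r).openIdx, w e ≤ cost w (node l r) := by
  simp only [openIdx, cost]
  exact le_add_left (prod_le_prod_of_subset hw (Finset.symmDiff_subset_union (s := openIdx l)))

/-! ### Slicing -/

/-- **Slicing** the index set `Z = s_sliced`: each slice is "a tensor network of `|V|` nodes, but
with all the edges in `s_sliced` removed", contracted "using the same tree as the original network".
[cite: GrayKourtis2021, §4.7.1] [cite: MorvanEtAl2024, Appendix G ("slicing (projecting) certain carefully chosen indices")] -/
def slice (Z : Finset E) : CTree E → CTree E
  | leaf s => leaf (s \ Z)
  | node l r => node (slice Z l) (slice Z r)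

/-- Slicing removes the sliced indices from every incidence set: `s_v ↦ s_v \ Z` at every vertex
("it is simple to compute the new width and cost with any index removed").
[cite: GrayKourtis2021, §4.7.1] -/
theorem openIdx_slice (Z : Finset E) (t : CTree E) : (slice Z t).openIdx = t.openIdx \ Z := by
  induction t with
  | leaf s => rfl
  | node l r ihl ihr => simp only [slice, openIdx, ihl, ihr, symmDiff_sdiff_sdiff]

/-- The **total sliced cost** `C_s = d_sliced · C(sliced tree)` (every one of the `d_sliced` slices
is contracted with the same tree). [cite: GrayKourtis2021, §4.7.1 (C_s)] -/
def slicedCost (w : E → ℕ) (Z : Finset E) (t : CTree E) : ℕ := numSlices w Z * cost w (slice Z t)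

/-- Unfolding of `slicedCost`. [cite: GrayKourtis2021, §4.7.1 (C_s)] -/
theorem slicedCost_eq (w : E → ℕ) (Z : Finset E) (t : CTree E) :
    slicedCost w Z t = numSlices w Z * cost w (slice Z t) := rfl

/-- `C_s` as the sum over the `d_sliced` independent slice contractions ("each of which can be
contracted independently … ‘embarrassingly parallel’"; DeCross: "breaks the computation into many
independent tasks"). [cite: GrayKourtis2021, §4.7.1] [cite: DeCrossEtAl2025, §III B] -/
theorem slicedCost_eq_sum (w : E → ℕ) (Z : Finset E) (t : CTree E) :
    slicedCost w Z t = ∑ _x : (e : Z) → Fin (w e), cost w (slice Z t) := by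
  rw [Finset.sum_const, Finset.card_univ, card_sliceAssignments, smul_eq_mul, slicedCost]

/-- Each slice alone is no more expensive than the unsliced contraction: `C(slice) ≤ C`.
[cite: GrayKourtis2021, §4.7.1] -/
theorem cost_slice_le {w : E → ℕ} (hw : ∀ e, 1 ≤ w e) (Z : Finset E) (t : CTree E) :
    cost w (slice Z t) ≤ cost w t := by
  induction t with
  | leaf s => simp [slice, cost]
  | node l r ihl ihr =>
    simp only [slice, cost, openIdx_slice, union_sdiff_eq]
    exact Nat.add_le_add (Nat.add_le_add ihl ihr) (prod_le_prod_of_subset hw Finset.sdiff_subset)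

/-- One contraction step: `∏_{e∈U} w(e) ≤ d_sliced · ∏_{e ∈ U \ Z} w(e)` (equality iff the step
involves every sliced index). [cite: GrayKourtis2021, §4.7.1 ("redundantly repeated contractions")] -/
theorem prod_le_numSlices_mul_prod_sdiff {w : E → ℕ} (hw : ∀ e, 1 ≤ w e) (U Z : Finset E) :
    ∏ e ∈ U, w e ≤ numSlices w Z * ∏ e ∈ U \ Z, w e := by
  rw [← prod_sdiff_mul_prod_inter w U Z, mul_comm, numSlices]
  exact Nat.mul_le_mul_right _ (prod_le_prod_of_subset hw Finset.inter_subset_right)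

/-- One contraction step involving every sliced index costs the same after slicing (summed over
the slices): `∏_{e∈U} w(e) = d_sliced · ∏_{e ∈ U \ Z} w(e)` for `Z ⊆ U`. [cite: GrayKourtis2021, §4.7.1] -/
theorem prod_eq_numSlices_mul_prod_sdiff (w : E → ℕ) {U Z : Finset E} (h : Z ⊆ U) :
    ∏ e ∈ U, w e = numSlices w Z * ∏ e ∈ U \ Z, w e := by
  rw [← prod_sdiff_mul_prod_inter w U Z, mul_comm, numSlices, Finset.inter_eq_right.2 h]

/-- **Slicing never lowers the total cost**: `C ≤ C_s` ("the contraction cost of each sliced tensor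
network generally increases beyond `C / d_sliced` (due to redundantly repeated contractions) meaning
the total sliced cost, `C_s`, rises"; Morvan et al.: "alleviate the memory requirements … at the
expense of a larger time complexity"; DeCross et al.: "not always free … redundantly repeated
operations introduce significant overhead"). [cite: GrayKourtis2021, §4.7.1] [cite: MorvanEtAl2024, Appendix G] [cite: DeCrossEtAl2025, §III B] -/
theorem cost_le_slicedCost {w : E → ℕ} (hw : ∀ e, 1 ≤ w e) (Z : Finset E) (t : CTree E) :
    cost w t ≤ slicedCost w Z t := by
  unfold slicedCost
  induction t with
  | leaf s => simp [slice, cost]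
  | node l r ihl ihr =>
    simp only [slice, cost, openIdx_slice, union_sdiff_eq, Nat.mul_add]
    exact Nat.add_le_add (Nat.add_le_add ihl ihr) (prod_le_numSlices_mul_prod_sdiff hw _ Z)

/-- Every contraction step of the tree involves all the sliced indices `Z` (the no-overhead
condition). [cite: GrayKourtis2021, §4.7.1 ("redundantly repeated contractions")] -/
def EveryContractionContains (Z : Finset E) : CTree E → Prop
  | leaf _ => True
  | node l r => Z ⊆ openIdx l ∪ openIdx r ∧ EveryContractionContains Z l ∧
      EveryContractionContains Z r

/-- **No slicing overhead** when every contraction involves all sliced indices: `C_s = C` (the regime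
"even though the slicing reduces `W` by a factor of up to `2²⁶` …, it introduces no significant
overhead"; overhead comes only from contractions NOT containing a sliced index, which are
"redundantly repeated"). [cite: GrayKourtis2021, §4.7.1] [cite: DeCrossEtAl2025, §III B] -/
theorem slicedCost_eq_cost {w : E → ℕ} {Z : Finset E} {t : CTree E}
    (h : EveryContractionContains Z t) : slicedCost w Z t = cost w t := by
  unfold slicedCost
  induction t with
  | leaf s => simp [slice, cost]
  | node l r ihl ihr =>
    obtain ⟨hZ, hl, hr⟩ := h
    simp only [slice, cost, openIdx_slice, union_sdiff_eq, Nat.mul_add]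
    rw [ihl hl, ihr hr, ← prod_eq_numSlices_mul_prod_sdiff w hZ]

/-- **Slicing shrinks every tensor**: at each vertex the sliced tensor times `∏_{e ∈ s_v ∩ Z} w(e)`
is the original tensor size ("reduces `W` by a factor of up to `2²⁶`": the factor is the product of
the sliced dimensions present at the widest vertex). [cite: GrayKourtis2021, §4.7.1 (i)] [cite: DeCrossEtAl2025, §III B] -/
theorem prod_openIdx_slice_mul (w : E → ℕ) (Z : Finset E) (t : CTree E) :
    (∏ e ∈ (slice Z t).openIdx, w e) * ∏ e ∈ t.openIdx ∩ Z, w e = ∏ e ∈ t.openIdx, w e := by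
  rw [openIdx_slice, prod_sdiff_mul_prod_inter]

/-- **Slicing never increases the memory footprint**: `2^{W_s} ≤ 2^W` ("the contraction width and
thus required memory of each sliced tensor network, `W_s`, is generally reduced"; Morvan et al.:
"Each slice yields a tensor network that requires less memory to be contracted").
[cite: GrayKourtis2021, §4.7.1 (i)] [cite: MorvanEtAl2024, Appendix G] -/
theorem maxSize_slice_le {w : E → ℕ} (hw : ∀ e, 1 ≤ w e) (Z : Finset E) (t : CTree E) :
    maxSize w (slice Z t) ≤ maxSize w t := by
  induction t with
  | leaf s => exact prod_le_prod_of_subset hw Finset.sdiff_subset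
  | node l r ihl ihr =>
    simp only [slice, maxSize, openIdx_slice, symmDiff_sdiff_sdiff]
    exact max_le_max (max_le_max ihl ihr) (prod_le_prod_of_subset hw Finset.sdiff_subset)

/-- Qubit form: `W_s ≤ W`. [cite: GrayKourtis2021, §4.7.1 (i)] -/
theorem width_slice_le (Z : Finset E) (t : CTree E) : width (slice Z t) ≤ width t := by
  induction t with
  | leaf s => exact Finset.card_le_card Finset.sdiff_subset
  | node l r ihl ihr =>
    simp only [slice, width, openIdx_slice, symmDiff_sdiff_sdiff]
    exact max_le_max (max_le_max ihl ihr) (Finset.card_le_card Finset.sdiff_subset)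

/-- The trade-off in one line: `C ≤ C_s ≤ d_sliced · C` (the total sliced cost lies between the
unsliced cost and `d_sliced` full repetitions). [cite: GrayKourtis2021, §4.7.1] -/
theorem slicedCost_le_numSlices_mul_cost {w : E → ℕ} (hw : ∀ e, 1 ≤ w e) (Z : Finset E)
    (t : CTree E) : slicedCost w Z t ≤ numSlices w Z * cost w t :=
  Nat.mul_le_mul_left _ (cost_slice_le hw Z t)

end CTree

end Literature.Computability.QuantumComplexity.TensorContraction
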